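import Literature.NumberTheory.Automorphic.UnramifiedLocalDualHeckeIntegralGL2
import HarnessLib

/-!
# Absolute bounds for the unramified local Hecke integrals of `GL₂`:
# `∫ |W°(diag(a,1))| |a|^{σ-1/2} d×a ≤ vol · |W°(1)| · ∑_m (m+1)² (A q^{-σ})^m`
# (Jacquet–Langlands (1970), p. 172: absolute convergence of `Ψ(s, φ) = ∏_v Ψ(s, W_v)`)

Topic `NumberTheory/Automorphic`; namespace `Literature.NumberTheory.Automorphic`. Theorems only (no
definition, no named fact, no instance). The uniform-in-the-place estimate of the absolute local Hecke
integrals at the good places that feeds the absolute convergence of the global Hecke integral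
`∫_{𝕀_K} W_φ(diag(a,1)) |a|^{s-1/2} d×a` of a pure tensor for `re s` large (Jacquet–Langlands (1970),
proof of Thm. 11.1, p. 172: "`Ψ(g, s, φ₁)` … is absolutely convergent … for `Re s` sufficiently large";
Cogdell (2004), proof of Thm. 2.2). With the notation of `UnramifiedLocalHeckeIntegralGL2` (`v` spherical
with Hecke eigenvalues of `α = {x₀, x₁}`, `W° = W_{Λ,v}`, `q = #𝓀`) and a bound `|xᵢ| ≤ A`:

* `schur_fin_two_vecCons_zero` — `s_{(m,0)}(x) = h_m(x)` (Jacobi–Trudi in two variables);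
* `norm_hsymm_le` — `|h_m(x)| ≤ (m+1)ⁿ Aᵐ` for `|xᵢ| ≤ A`;
* `norm_whittakerModel_diagGL2_pow_le` — **Shintani's bound** `|W°(diag(ϖ^m, 1))| ≤ |Λ(v)| (m+1)² (A/√q)ᵐ`
  (`whittakerModel_piPowGL_eq`: `W°(diag(ϖ^m,1)) = q^{-m/2} s_{(m,0)}(x) Λ(v)`);
* `integral_norm_whittakerModel_diagGL2_mul_cpow_le` (**main, direct**): for a Haar measure `μ'` on `Fˣ`
  and `A q^{-re s} < 1`,

    `∫_{Fˣ} |W°(diag(a,1)) |a|^{s-1/2}| dμ'(a) ≤ μ'(𝒪ˣ) · |Λ(v)| · ∑_m (m+1)² (A q^{-re s})^m`;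

* `integral_norm_tildeFn_whittakerModel_diagGL2_mul_cpow_le` (**main, dual**): the same bound for
  `W̃°(g) = W°(w ᵗg⁻¹)` when `|x₀ x₁| = 1` (unitary central character): on the shell `|a| = q^{-m}`,
  `W̃°(diag(a,1)) = e₂(α)^{-m} W°(diag(ϖ^m,1))` (`UnramifiedLocalDualHeckeIntegralGL2`);
* `tsum_sq_mul_pow_le` — the elementary `∑_m (m+1)² yᵐ ≤ 1 + C y` for `0 ≤ y ≤ 1/2` with an absolute
  constant `C`, so that the local bounds are `vol · |Λ(v)| · (1 + O(q^{1/2 - re s}))` when `A ≤ √q`.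

## References

* H. Jacquet, R. P. Langlands, *Automorphic Forms on GL(2)*, LNM 114 (1970), Prop. 3.5 and proof of
  Thm. 11.1, p. 172 [JacquetLanglands1970].
* T. Shintani, *On an explicit formula for class-1 Whittaker functions on GL_n over P-adic fields*,
  Proc. Japan Acad. 52 (1976) [Shintani1976].
* J. W. Cogdell, *Lectures on L-functions, converse theorems, and functoriality for GL_n* (2004), Thm. 3.3,
  proof of Thm. 2.2 [CogdellAnalyticTheory2004].
-/

noncomputable section

open scoped MatrixGroups NNReal ENNReal
open MeasureTheory ValuativeRel Polynomial Filter Finset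
  Literature.NumberTheory.GaloisRepresentations.IsNonarchimedeanLocalField
  Literature.NumberTheory.EllipticCurves.Hida2000Thm326
  Literature.RingTheory.SymmetricFunctions.SymmPoly

namespace Literature.NumberTheory.Automorphic

/-! ### 1. Symmetric-function bookkeeping -/

section Symm

/-- **Jacobi–Trudi in two variables**: `s_{(m,0)}(x) = h_m(x)`. [cite: Macdonald1995, Ch. I (3.4)] -/
theorem schur_fin_two_vecCons_zero {R : Type*} [CommRing R] (x : Fin 2 → R) (m : ℕ) :
    schur x ![m, 0] = hsymm x m := by
  rw [schur, Matrix.det_fin_two]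
  simp only [Matrix.of_apply, Matrix.cons_val_zero, Matrix.cons_val_one, Fin.val_zero, Fin.val_one,
    Nat.cast_zero, Nat.cast_one, sub_zero, add_zero, zero_sub]
  rw [hsymmZ_natCast, show (-1 : ℤ) + 1 = 0 by norm_num, hsymmZ_zero, hsymmZ_of_neg x (by norm_num : (-1 : ℤ) < 0),
    mul_one, mul_zero, sub_zero]

/-- `|h_m(x)| ≤ (m+1)ⁿ Aᵐ` when `|xᵢ| ≤ A` (the monomial expansion of `h_m` has at most `(m+1)ⁿ` terms,
each of absolute value `≤ Aᵐ`). [folklore] -/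
theorem norm_hsymm_le {n : ℕ} (x : Fin n → ℂ) {A : ℝ} (hA0 : 0 ≤ A) (hA : ∀ i, ‖x i‖ ≤ A) (m : ℕ) :
    ‖hsymm x m‖ ≤ ((m : ℝ) + 1) ^ n * A ^ m := by
  classical
  rw [hsymm_eq_sum_piAntidiag]
  have hsub : piAntidiag (univ : Finset (Fin n)) m ⊆ Fintype.piFinset fun _ : Fin n => range (m + 1) := by
    intro μ hμ
    rw [mem_piAntidiag] at hμ
    rw [Fintype.mem_piFinset]
    intro i
    rw [mem_range, Nat.lt_succ_iff, ← hμ.1]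
    exact Finset.single_le_sum (fun j _ => Nat.zero_le (μ j)) (mem_univ i)
  have hcard : ((piAntidiag (univ : Finset (Fin n)) m).card : ℝ) ≤ ((m : ℝ) + 1) ^ n := by
    have h := Finset.card_le_card hsub
    rw [Fintype.card_piFinset_const, card_range] at h
    exact_mod_cast h
  have hterm : ∀ μ ∈ piAntidiag (univ : Finset (Fin n)) m, ‖∏ i, x i ^ μ i‖ ≤ A ^ m := by
    intro μ hμ
    rw [mem_piAntidiag] at hμ
    rw [norm_prod, ← hμ.1, ← Finset.prod_pow_eq_pow_sum]
    refine Finset.prod_le_prod (fun i _ => norm_nonneg _) fun i _ => ?_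
    rw [norm_pow]
    exact pow_le_pow_left₀ (norm_nonneg _) (hA i) _
  calc ‖∑ μ ∈ piAntidiag (univ : Finset (Fin n)) m, ∏ i, x i ^ μ i‖
      ≤ ∑ μ ∈ piAntidiag (univ : Finset (Fin n)) m, ‖∏ i, x i ^ μ i‖ := norm_sum_le _ _
    _ ≤ ∑ _μ ∈ piAntidiag (univ : Finset (Fin n)) m, A ^ m := Finset.sum_le_sum hterm
    _ = (piAntidiag (univ : Finset (Fin n)) m).card * A ^ m := by rw [Finset.sum_const, nsmul_eq_mul]
    _ ≤ ((m : ℝ) + 1) ^ n * A ^ m := by gcongr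

/-- **The elementary majorant**: `∑_m (m+1)² yᵐ ≤ 1 + C y` for `0 ≤ y ≤ 1/2`, with an absolute constant
`C ≥ 0` (and the series converges). [folklore] -/
theorem tsum_sq_mul_pow_le : ∃ C : ℝ, 0 ≤ C ∧ ∀ y : ℝ, 0 ≤ y → y ≤ 1 / 2 →
    Summable (fun m : ℕ => ((m : ℝ) + 1) ^ 2 * y ^ m) ∧
      ∑' m : ℕ, ((m : ℝ) + 1) ^ 2 * y ^ m ≤ 1 + C * y := by
  -- `C = ∑_m (m+2)² 2^{-m}`
  have hhalf : ‖(1 / 2 : ℝ)‖ < 1 := by rw [Real.norm_eq_abs, abs_of_nonneg (by norm_num)]; norm_num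
  have hC : Summable fun m : ℕ => ((m : ℝ) + 2) ^ 2 * (1 / 2 : ℝ) ^ m := by
    have h2 := summable_pow_mul_geometric_of_norm_lt_one 2 hhalf
    have h1 := summable_pow_mul_geometric_of_norm_lt_one 1 hhalf
    have h0 := summable_geometric_of_norm_lt_one hhalf
    have : (fun m : ℕ => ((m : ℝ) + 2) ^ 2 * (1 / 2 : ℝ) ^ m) =
        fun m : ℕ => (m : ℝ) ^ 2 * (1 / 2 : ℝ) ^ m + 4 * ((m : ℝ) ^ 1 * (1 / 2 : ℝ) ^ m) + 4 * (1 / 2 : ℝ) ^ m := by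
      funext m; ring
    rw [this]
    exact (h2.add (h1.mul_left 4)).add (h0.mul_left 4)
  refine ⟨∑' m : ℕ, ((m : ℝ) + 2) ^ 2 * (1 / 2 : ℝ) ^ m,
    tsum_nonneg fun m => mul_nonneg (sq_nonneg _) (pow_nonneg (by norm_num) _), fun y hy0 hy => ?_⟩
  have hy1 : ‖y‖ < 1 := by rw [Real.norm_eq_abs, abs_of_nonneg hy0]; linarith
  have hsum : Summable fun m : ℕ => ((m : ℝ) + 1) ^ 2 * y ^ m := by
    have h2 := summable_pow_mul_geometric_of_norm_lt_one 2 hy1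
    have h1 := summable_pow_mul_geometric_of_norm_lt_one 1 hy1
    have h0 := summable_geometric_of_norm_lt_one hy1
    have : (fun m : ℕ => ((m : ℝ) + 1) ^ 2 * y ^ m) =
        fun m : ℕ => (m : ℝ) ^ 2 * y ^ m + 2 * ((m : ℝ) ^ 1 * y ^ m) + y ^ m := by
      funext m; ring
    rw [this]
    exact (h2.add (h1.mul_left 2)).add h0
  refine ⟨hsum, ?_⟩
  -- split off `m = 0` and compare the tail termwise with `y · (m+2)² 2^{-m}`
  rw [hsum.tsum_eq_zero_add]
  simp only [Nat.cast_zero, zero_add, one_pow, pow_zero, mul_one]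
  refine add_le_add le_rfl ?_
  have htail : ∀ m : ℕ, (((m + 1 : ℕ) : ℝ) + 1) ^ 2 * y ^ (m + 1) ≤ y * (((m : ℝ) + 2) ^ 2 * (1 / 2 : ℝ) ^ m) := by
    intro m
    rw [Nat.cast_succ, show ((m : ℝ) + 1 + 1) = (m : ℝ) + 2 by ring]
    have hym : y ^ m ≤ (1 / 2 : ℝ) ^ m := pow_le_pow_left₀ hy0 hy m
    calc ((m : ℝ) + 2) ^ 2 * y ^ (m + 1) = y * (((m : ℝ) + 2) ^ 2 * y ^ m) := by ring
      _ ≤ y * (((m : ℝ) + 2) ^ 2 * (1 / 2 : ℝ) ^ m) := by gcongr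
  have hsum1 : Summable fun m : ℕ => (((m + 1 : ℕ) : ℝ) + 1) ^ 2 * y ^ (m + 1) :=
    (summable_nat_add_iff 1).2 hsum
  calc ∑' m : ℕ, (((m + 1 : ℕ) : ℝ) + 1) ^ 2 * y ^ (m + 1)
      ≤ ∑' m : ℕ, y * (((m : ℝ) + 2) ^ 2 * (1 / 2 : ℝ) ^ m) := hsum1.tsum_le_tsum htail (hC.mul_left y)
    _ = (∑' m : ℕ, ((m : ℝ) + 2) ^ 2 * (1 / 2 : ℝ) ^ m) * y := by rw [tsum_mul_left, mul_comm]

end Symm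

/-! ### 2. Shintani's bound for `W°(diag(ϖ^m, 1))` -/

section Shintani

variable {F : Type*} [Field F] [ValuativeRel F] [TopologicalSpace F] [IsNonarchimedeanLocalField F]
  {V : Type*} [AddCommGroup V] [Module ℂ V] (π : Representation ℂ (GL (Fin 2) F) V)

/-- `b((m, 0)) = m` for `GL₂` (private copy of the lemma of `WhittakerFactorizationGL2`, a heavy global
file not imported here). [folklore] -/
private theorem torusExponent_vecCons_zero' (m : ℕ) : torusExponent (n := 2) ![m, 0] = m := by
  simp [torusExponent, Fin.sum_univ_two]

/-- **Shintani's formula for `GL₂` at `diag(ϖ^m, 1)`**: `W°(diag(ϖ^m,1)) = (√q)^{-m} h_m(x) Λ(v)`.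
[cite: Shintani1976, Theorem] -/
theorem whittakerModel_diagGL2_pow_eq_hsymm {ϖ : Fˣ} (hϖ : (valuation F).IsUniformizer (ϖ : F))
    {ψ : AddChar F Circle} (hψ0 : ψ.HasConductorExp 0) {Λ : Module.Dual ℂ V}
    (hΛ : Λ ∈ whittakerFunctionals π ψ) {v : V} (hv : v ∈ π.fixedPoints (glInt 2 F))
    {α : Multiset ℂ} {x : Fin 2 → ℂ} (hx : (univ : Finset (Fin 2)).val.map x = α)
    (hT : ∀ r, 1 ≤ r → r ≤ 2 → heckeT π ϖ r v =
      ((((Real.sqrt (residueFieldCard F)) ^ (r * (2 - r)) : ℝ) : ℂ) * α.esymm r) • v) (m : ℕ) :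
    whittakerModel π Λ v (diagGL2 (ϖ ^ m) 1) =
      ((Real.sqrt (residueFieldCard F) : ℝ) : ℂ) ^ (-(m : ℤ)) * hsymm x m * Λ v := by
  have hϖu : IsUniformizingElement (ϖ : F) := isUniformizingElement_of_isUniformizer hϖ
  have hmk : Units.mk0 (ϖ : F) hϖu.ne_zero = ϖ := Units.mk0_val _ _
  have hT' : ∀ r, 1 ≤ r → r ≤ 2 → heckeT π (Units.mk0 (ϖ : F) hϖu.ne_zero) r v =
      ((((Real.sqrt (residueFieldCard F)) ^ (r * (2 - r)) : ℝ) : ℂ) * esymm x r) • v := by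
    intro r hr1 hr2
    rw [hmk, hT r hr1 hr2, esymm_eq_multiset_esymm, hx]
  have hmu : Antitone (![m, 0] : Fin 2 → ℕ) := by
    intro i j hij
    fin_cases i <;> fin_cases j
    · exact le_rfl
    · exact Nat.zero_le _
    · exact absurd hij (by decide)
    · exact le_rfl
  have h := whittakerModel_piPowGL_eq π hϖu hψ0 hΛ hv hT' hmu
  rw [piPowGL_fin_two, hmk, pow_zero, torusExponent_vecCons_zero', schur_fin_two_vecCons_zero] at h
  exact h

/-- **Shintani's bound**: `|W°(diag(ϖ^m, 1))| ≤ |Λ(v)| (m+1)² (A/√q)ᵐ` for `|xᵢ| ≤ A`.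
[cite: Shintani1976, Theorem] [cite: JacquetLanglands1970, Prop. 3.5] -/
theorem norm_whittakerModel_diagGL2_pow_le {ϖ : Fˣ} (hϖ : (valuation F).IsUniformizer (ϖ : F))
    {ψ : AddChar F Circle} (hψ0 : ψ.HasConductorExp 0) {Λ : Module.Dual ℂ V}
    (hΛ : Λ ∈ whittakerFunctionals π ψ) {v : V} (hv : v ∈ π.fixedPoints (glInt 2 F))
    {α : Multiset ℂ} {x : Fin 2 → ℂ} (hx : (univ : Finset (Fin 2)).val.map x = α)
    (hT : ∀ r, 1 ≤ r → r ≤ 2 → heckeT π ϖ r v =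
      ((((Real.sqrt (residueFieldCard F)) ^ (r * (2 - r)) : ℝ) : ℂ) * α.esymm r) • v)
    {A : ℝ} (hA0 : 0 ≤ A) (hA : ∀ a ∈ α, ‖a‖ ≤ A) (m : ℕ) :
    ‖whittakerModel π Λ v (diagGL2 (ϖ ^ m) 1)‖ ≤
      ‖Λ v‖ * (((m : ℝ) + 1) ^ 2 * (A / Real.sqrt (residueFieldCard F)) ^ m) := by
  have hq0 : (0 : ℝ) < Real.sqrt (residueFieldCard F) :=
    Real.sqrt_pos.2 (by exact_mod_cast (zero_lt_one.trans (one_lt_residueFieldCard F)))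
  have hxA : ∀ i, ‖x i‖ ≤ A := fun i => hA _ (by rw [← hx]; exact Multiset.mem_map_of_mem _ (mem_univ_val i))
  rw [whittakerModel_diagGL2_pow_eq_hsymm π hϖ hψ0 hΛ hv hx hT m, norm_mul, norm_mul, norm_zpow,
    Complex.norm_real, Real.norm_of_nonneg hq0.le, div_pow, zpow_neg, zpow_natCast]
  have hh := norm_hsymm_le x hA0 hxA m
  calc (Real.sqrt (residueFieldCard F) ^ m)⁻¹ * ‖hsymm x m‖ * ‖Λ v‖
      ≤ (Real.sqrt (residueFieldCard F) ^ m)⁻¹ * (((m : ℝ) + 1) ^ 2 * A ^ m) * ‖Λ v‖ := by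
        gcongr
    _ = ‖Λ v‖ * (((m : ℝ) + 1) ^ 2 * (A ^ m / Real.sqrt (residueFieldCard F) ^ m)) := by
        rw [div_eq_mul_inv]; ring

end Shintani

/-! ### 3. The absolute local integrals -/

section Integral

variable {F : Type*} [Field F] [ValuativeRel F] [TopologicalSpace F] [IsNonarchimedeanLocalField F]
  {V : Type*} [AddCommGroup V] [Module ℂ V] (π : Representation ℂ (GL (Fin 2) F) V)
  [MeasurableSpace F] [BorelSpace F]

/-- **The integral of the norm of a shell function**: if `f` vanishes on `|a| > 1` and `f = w m` on the
shell `|a| = q^{-m}`, with `∑ ‖w m‖ < ∞`, then `∫ ‖f‖ dμ' = μ'(𝒪ˣ) ∑_m ‖w m‖`. [folklore] -/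
theorem integral_norm_eq_tsum_shell (μ' : Measure Fˣ) [IsFiniteMeasureOnCompacts μ'] [μ'.IsMulLeftInvariant]
    {f : Fˣ → ℂ} {w : ℕ → ℂ} (hf0 : ∀ x : Fˣ, 1 < normAbs F (x : F) → f x = 0)
    (hfv : ∀ (m : ℕ) (x : Fˣ), normAbs F (x : F) = ((residueFieldCard F : ℝ≥0)⁻¹) ^ (m : ℤ) → f x = w m)
    (hw : Summable fun m => ‖w m‖) :
    ∫ x, ‖f x‖ ∂μ' = (μ' {x : Fˣ | valuation F (x : F) = 1}).toReal * ∑' m, ‖w m‖ := by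
  have h := integral_units_eq_tsum_shell μ' (f := fun x => ((‖f x‖ : ℝ) : ℂ)) (v := fun m => ((‖w m‖ : ℝ) : ℂ))
    (fun x hx => by rw [hf0 x hx, norm_zero, Complex.ofReal_zero])
    (fun m x hx => by rw [hfv m x hx])
    (by simpa only [Complex.norm_real, norm_norm] using hw)
  rw [integral_complex_ofReal, ← Complex.ofReal_tsum, ← Complex.ofReal_mul] at h
  exact_mod_cast h

/-- **Absolute bound for the unramified local Hecke integral of `GL₂`** (direct side). With the notation
of the file docstring, for every Haar measure `μ'` on `Fˣ`, `|xᵢ| ≤ A` and `A q^{-re s} < 1`,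

  `∫_{Fˣ} |W°(diag(a,1)) |a|^{s-1/2}| dμ'(a) ≤ μ'(𝒪ˣ) · |Λ(v)| · ∑_m (m+1)² (A q^{-re s})ᵐ`.

[cite: JacquetLanglands1970, Prop. 3.5 and p. 172] [cite: CogdellAnalyticTheory2004, Thm. 3.3] -/
theorem integral_norm_whittakerModel_diagGL2_mul_cpow_le {ϖ : Fˣ} (hϖ : (valuation F).IsUniformizer (ϖ : F))
    {ψ : AddChar F Circle} (hψ0 : ψ.HasConductorExp 0) {Λ : Module.Dual ℂ V}
    (hΛ : Λ ∈ whittakerFunctionals π ψ) {v : V} (hv : v ∈ π.fixedPoints (glInt 2 F))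
    {α : Multiset ℂ} {x : Fin 2 → ℂ} (hx : (univ : Finset (Fin 2)).val.map x = α)
    (hT : ∀ r, 1 ≤ r → r ≤ 2 → heckeT π ϖ r v =
      ((((Real.sqrt (residueFieldCard F)) ^ (r * (2 - r)) : ℝ) : ℂ) * α.esymm r) • v)
    (μ' : Measure Fˣ) [μ'.IsHaarMeasure] {A : ℝ} (hA0 : 0 ≤ A) (hA : ∀ a ∈ α, ‖a‖ ≤ A)
    {s : ℂ} (hsA : A * (residueFieldCard F : ℝ) ^ (-s.re) < 1) :
    Integrable (fun a : Fˣ => whittakerModel π Λ v (diagGL2 a 1) *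
        (((normAbs F (a : F) : ℝ≥0) : ℝ) : ℂ) ^ (s - 1 / 2)) μ' ∧
    ∫ a, ‖whittakerModel π Λ v (diagGL2 a 1) * (((normAbs F (a : F) : ℝ≥0) : ℝ) : ℂ) ^ (s - 1 / 2)‖ ∂μ' ≤
      (μ' {x : Fˣ | valuation F (x : F) = 1}).toReal *
        (‖Λ v‖ * ∑' m : ℕ, ((m : ℝ) + 1) ^ 2 * (A * (residueFieldCard F : ℝ) ^ (-s.re)) ^ m) := by
  classical
  haveI : T2Space F := (isLocalField F).toT2Space
  haveI : BorelSpace Fˣ := Units.borelSpace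
  have hq1 : (1 : ℝ) < (residueFieldCard F : ℝ) := by exact_mod_cast one_lt_residueFieldCard F
  have hq0 : (0 : ℝ) < (residueFieldCard F : ℝ) := zero_lt_one.trans hq1
  have hsq0 : (0 : ℝ) < Real.sqrt (residueFieldCard F) := Real.sqrt_pos.2 hq0
  set y : ℝ := A * (residueFieldCard F : ℝ) ^ (-s.re) with hy_def
  have hy0 : 0 ≤ y := mul_nonneg hA0 (Real.rpow_nonneg hq0.le _)
  have hqs : ‖(residueFieldCard F : ℂ) ^ (-s)‖ = (residueFieldCard F : ℝ) ^ (-s.re) := by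
    rw [Complex.norm_natCast_cpow_of_pos (zero_lt_one.trans (one_lt_residueFieldCard F)), Complex.neg_re]
  -- `F2` applies: `|a q^{-s}| ≤ y < 1`
  have hs : ∀ a ∈ α, ‖a * (residueFieldCard F : ℂ) ^ (-s)‖ < 1 := fun a ha => by
    rw [norm_mul, hqs]
    exact lt_of_le_of_lt (mul_le_mul_of_nonneg_right (hA a ha) (Real.rpow_nonneg hq0.le _)) hsA
  refine ⟨(integrable_and_integral_whittakerModel_diagGL2_mul_cpow π hϖ hψ0 hΛ hv hx hT μ' hs).1, ?_⟩
  have hϖn : normAbs F (ϖ : F) = (residueFieldCard F : ℝ≥0)⁻¹ := normAbs_uniformizer_holds hϖ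
  set t : ℂ := (residueFieldCard F : ℂ) ^ (-s) with ht_def
  set sq : ℂ := ((Real.sqrt (residueFieldCard F) : ℝ) : ℂ) with hsq_def
  set w : ℕ → ℂ := fun m => whittakerModel π Λ v (diagGL2 (ϖ ^ m) 1) * (sq * t) ^ m with hw_def
  -- the shell structure of the integrand (as in `UnramifiedLocalHeckeIntegralGL2`)
  have hr0 : (0 : ℝ) < (((residueFieldCard F : ℝ≥0)⁻¹ : ℝ≥0) : ℝ) := by
    exact_mod_cast inv_residueFieldCard_pos (F := F)
  set f : Fˣ → ℂ := fun a => whittakerModel π Λ v (diagGL2 a 1) *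
    (((normAbs F (a : F) : ℝ≥0) : ℝ) : ℂ) ^ (s - 1 / 2) with hf_def
  have hf0 : ∀ a : Fˣ, 1 < normAbs F (a : F) → f a = 0 := fun a ha => by
    simp only [hf_def]
    rw [whittakerModel_diagGL2_eq_zero_of_one_lt π hψ0 hΛ hv ha, zero_mul]
  have hfv : ∀ (m : ℕ) (a : Fˣ), normAbs F (a : F) = ((residueFieldCard F : ℝ≥0)⁻¹) ^ (m : ℤ) →
      f a = w m := by
    intro m a ha
    set u : Fˣ := (ϖ ^ m)⁻¹ * a with hu_def
    have hau : a = ϖ ^ m * u := by rw [hu_def, mul_inv_cancel_left]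
    have hu : valuation F (u : F) = 1 := by
      rw [← normAbs_eq_one_iff_valuation_eq_one, hu_def, Units.val_mul, Units.val_inv_eq_inv_val,
        Units.val_pow_eq_pow_val, map_mul, map_inv₀, map_pow, hϖn, ha, zpow_natCast, inv_mul_cancel₀]
      exact pow_ne_zero _ inv_residueFieldCard_pos.ne'
    have hWa : whittakerModel π Λ v (diagGL2 a 1) = whittakerModel π Λ v (diagGL2 (ϖ ^ m) 1) := by
      rw [hau, whittakerModel_diagGL2_mul_of_valuation_eq_one π Λ hv _ hu]
    have habs : (((normAbs F (a : F) : ℝ≥0) : ℝ) : ℂ) ^ (s - 1 / 2) = (sq * t) ^ m := by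
      rw [ha, NNReal.coe_zpow, ofReal_zpow_cpow hr0, inv_residueFieldCard_cpow_sub_one_half, zpow_natCast]
    simp only [hf_def, hw_def]
    rw [hWa, habs]
  -- the shell values are dominated by `b m = ‖Λ v‖ (m+1)² yᵐ`
  have hwle : ∀ m, ‖w m‖ ≤ ‖Λ v‖ * (((m : ℝ) + 1) ^ 2 * y ^ m) := by
    intro m
    simp only [hw_def]
    rw [norm_mul, norm_pow, norm_mul, hsq_def, Complex.norm_real, Real.norm_of_nonneg hsq0.le, ht_def, hqs]
    have h := norm_whittakerModel_diagGL2_pow_le π hϖ hψ0 hΛ hv hx hT hA0 hA m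
    calc ‖whittakerModel π Λ v (diagGL2 (ϖ ^ m) 1)‖ * (Real.sqrt (residueFieldCard F) * (residueFieldCard F : ℝ) ^ (-s.re)) ^ m
        ≤ ‖Λ v‖ * (((m : ℝ) + 1) ^ 2 * (A / Real.sqrt (residueFieldCard F)) ^ m) *
            (Real.sqrt (residueFieldCard F) * (residueFieldCard F : ℝ) ^ (-s.re)) ^ m := by
          gcongr
      _ = ‖Λ v‖ * (((m : ℝ) + 1) ^ 2 * y ^ m) := by
          rw [hy_def, div_pow, mul_pow, mul_pow]
          field_simp
  have hy1 : ‖y‖ < 1 := by rw [Real.norm_eq_abs, abs_of_nonneg hy0]; exact hsA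
  have hbsum : Summable fun m : ℕ => ((m : ℝ) + 1) ^ 2 * y ^ m := by
    have h2 := summable_pow_mul_geometric_of_norm_lt_one 2 hy1
    have h1 := summable_pow_mul_geometric_of_norm_lt_one 1 hy1
    have h0 := summable_geometric_of_norm_lt_one hy1
    have : (fun m : ℕ => ((m : ℝ) + 1) ^ 2 * y ^ m) =
        fun m : ℕ => (m : ℝ) ^ 2 * y ^ m + 2 * ((m : ℝ) ^ 1 * y ^ m) + y ^ m := by
      funext m; ring
    rw [this]
    exact (h2.add (h1.mul_left 2)).add h0
  have hwsum : Summable fun m => ‖w m‖ :=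
    Summable.of_nonneg_of_le (fun m => norm_nonneg _) hwle (hbsum.mul_left _)
  rw [integral_norm_eq_tsum_shell μ' hf0 hfv hwsum]
  refine mul_le_mul_of_nonneg_left ?_ ENNReal.toReal_nonneg
  rw [← tsum_mul_left]
  exact hwsum.tsum_le_tsum hwle (hbsum.mul_left _)

/-- **Absolute bound for the unramified local DUAL Hecke integral of `GL₂`**: the same bound for
`W̃°(g) = W°(w ᵗg⁻¹)` when `|e₂(α)| = |x₀ x₁| = 1` (on the shell `|a| = q^{-m}`,
`W̃°(diag(a,1)) = e₂(α)^{-m} W°(diag(ϖ^m,1))`). [cite: JacquetLanglands1970, Prop. 3.5 and p. 172] -/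
theorem integral_norm_tildeFn_whittakerModel_diagGL2_mul_cpow_le {ϖ : Fˣ}
    (hϖ : (valuation F).IsUniformizer (ϖ : F))
    {ψ : AddChar F Circle} (hψ0 : ψ.HasConductorExp 0) {Λ : Module.Dual ℂ V}
    (hΛ : Λ ∈ whittakerFunctionals π ψ) {v : V} (hv : v ∈ π.fixedPoints (glInt 2 F))
    {α : Multiset ℂ} {x : Fin 2 → ℂ} (hx : (univ : Finset (Fin 2)).val.map x = α)
    (he1 : ‖α.esymm 2‖ = 1)
    (hT : ∀ r, 1 ≤ r → r ≤ 2 → heckeT π ϖ r v =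
      ((((Real.sqrt (residueFieldCard F)) ^ (r * (2 - r)) : ℝ) : ℂ) * α.esymm r) • v)
    (μ' : Measure Fˣ) [μ'.IsHaarMeasure] {A : ℝ} (hA0 : 0 ≤ A) (hA : ∀ a ∈ α, ‖a‖ ≤ A)
    {s : ℂ} (hsA : A * (residueFieldCard F : ℝ) ^ (-s.re) < 1) :
    Integrable (fun a : Fˣ => tildeFn (whittakerModel π Λ v) (diagGL2 a 1) *
        (((normAbs F (a : F) : ℝ≥0) : ℝ) : ℂ) ^ (s - 1 / 2)) μ' ∧
    ∫ a, ‖tildeFn (whittakerModel π Λ v) (diagGL2 a 1) * (((normAbs F (a : F) : ℝ≥0) : ℝ) : ℂ) ^ (s - 1 / 2)‖ ∂μ' ≤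
      (μ' {x : Fˣ | valuation F (x : F) = 1}).toReal *
        (‖Λ v‖ * ∑' m : ℕ, ((m : ℝ) + 1) ^ 2 * (A * (residueFieldCard F : ℝ) ^ (-s.re)) ^ m) := by
  classical
  haveI : T2Space F := (isLocalField F).toT2Space
  haveI : BorelSpace Fˣ := Units.borelSpace
  have hq1 : (1 : ℝ) < (residueFieldCard F : ℝ) := by exact_mod_cast one_lt_residueFieldCard F
  have hq0 : (0 : ℝ) < (residueFieldCard F : ℝ) := zero_lt_one.trans hq1
  have hsq0 : (0 : ℝ) < Real.sqrt (residueFieldCard F) := Real.sqrt_pos.2 hq0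
  set y : ℝ := A * (residueFieldCard F : ℝ) ^ (-s.re) with hy_def
  have hy0 : 0 ≤ y := mul_nonneg hA0 (Real.rpow_nonneg hq0.le _)
  have hqs : ‖(residueFieldCard F : ℂ) ^ (-s)‖ = (residueFieldCard F : ℝ) ^ (-s.re) := by
    rw [Complex.norm_natCast_cpow_of_pos (zero_lt_one.trans (one_lt_residueFieldCard F)), Complex.neg_re]
  have he0 : α.esymm 2 ≠ 0 := fun h => by rw [h, norm_zero] at he1; exact zero_ne_one he1
  have hϖn : normAbs F (ϖ : F) = (residueFieldCard F : ℝ≥0)⁻¹ := normAbs_uniformizer_holds hϖ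
  have hpow : ∀ k : ℕ, diagGL2 (ϖ⁻¹ ^ k) (ϖ⁻¹ ^ k) = diagGL2 ϖ⁻¹ ϖ⁻¹ ^ k := fun k => by
    induction k with
    | zero => rw [pow_zero, pow_zero, diagGL2_one]
    | succ k ih => rw [pow_succ, pow_succ, diagGL2_mul, ih]
  set t : ℂ := (residueFieldCard F : ℂ) ^ (-s) with ht_def
  set sq : ℂ := ((Real.sqrt (residueFieldCard F) : ℝ) : ℂ) with hsq_def
  set e : ℂ := α.esymm 2 with he_def
  set w : ℕ → ℂ := fun m => e⁻¹ ^ m * (whittakerModel π Λ v (diagGL2 (ϖ ^ m) 1) * (sq * t) ^ m) with hw_def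
  have hr0 : (0 : ℝ) < (((residueFieldCard F : ℝ≥0)⁻¹ : ℝ≥0) : ℝ) := by
    exact_mod_cast inv_residueFieldCard_pos (F := F)
  set f : Fˣ → ℂ := fun a => tildeFn (whittakerModel π Λ v) (diagGL2 a 1) *
    (((normAbs F (a : F) : ℝ≥0) : ℝ) : ℂ) ^ (s - 1 / 2) with hf_def
  -- `W̃°(diag(a,1)) = Λ(π(diag(a,1)) π(diag(a⁻¹,a⁻¹)) v)`
  have htilde : ∀ a : Fˣ, tildeFn (whittakerModel π Λ v) (diagGL2 a 1) =
      Λ (π (diagGL2 a 1) (π (diagGL2 a⁻¹ a⁻¹) v)) := by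
    intro a
    rw [tildeFn_whittakerModel_diagGL2_of_mem_fixedPoints π Λ hv, ← Module.End.mul_apply, ← map_mul, ← diagGL2_mul,
      mul_inv_cancel, one_mul]
  have hcfix : ∀ a : Fˣ, π (diagGL2 a⁻¹ a⁻¹) v ∈ π.fixedPoints (glInt 2 F) := by
    intro a
    rw [Representation.mem_fixedPoints]
    intro k hk
    rw [← Module.End.mul_apply, ← map_mul,
      show k * diagGL2 a⁻¹ a⁻¹ = diagGL2 a⁻¹ a⁻¹ * k from ?_, map_mul, Module.End.mul_apply,
      (π.mem_fixedPoints _ v).1 hv k hk]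
    refine Matrix.GeneralLinearGroup.ext fun i j => ?_
    rw [Units.val_mul, Units.val_mul, coe_diagGL2, show (!![((a⁻¹ : Fˣ) : F), 0; 0, ((a⁻¹ : Fˣ) : F)] :
        Matrix (Fin 2) (Fin 2) F) = ((a⁻¹ : Fˣ) : F) • (1 : Matrix (Fin 2) (Fin 2) F) by
      ext i j; fin_cases i <;> fin_cases j <;> simp, Matrix.mul_smul, Matrix.smul_mul, Matrix.mul_one,
      Matrix.one_mul]
  have hf0 : ∀ a : Fˣ, 1 < normAbs F (a : F) → f a = 0 := fun a ha => by
    simp only [hf_def]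
    rw [htilde, ← whittakerModel_apply, whittakerModel_diagGL2_eq_zero_of_one_lt π hψ0 hΛ (hcfix a) ha, zero_mul]
  have hfv : ∀ (m : ℕ) (a : Fˣ), normAbs F (a : F) = ((residueFieldCard F : ℝ≥0)⁻¹) ^ (m : ℤ) →
      f a = w m := by
    intro m a ha
    set u : Fˣ := (ϖ ^ m)⁻¹ * a with hu_def
    have hau : a = ϖ ^ m * u := by rw [hu_def, mul_inv_cancel_left]
    have hu : valuation F (u : F) = 1 := by
      rw [← normAbs_eq_one_iff_valuation_eq_one, hu_def, Units.val_mul, Units.val_inv_eq_inv_val,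
        Units.val_pow_eq_pow_val, map_mul, map_inv₀, map_pow, hϖn, ha, zpow_natCast, inv_mul_cancel₀]
      exact pow_ne_zero _ inv_residueFieldCard_pos.ne'
    have hui : valuation F ((u⁻¹ : Fˣ) : F) = 1 := by
      rw [Units.val_inv_eq_inv_val, map_inv₀, hu, inv_one]
    have hcentral : π (diagGL2 a⁻¹ a⁻¹) v = e⁻¹ ^ m • v := by
      rw [hau, mul_inv, show (ϖ ^ m)⁻¹ = ϖ⁻¹ ^ m from inv_pow _ _, diagGL2_mul, map_mul, Module.End.mul_apply,
        (π.mem_fixedPoints _ v).1 hv _ (diagGL2_mem_glInt hui hui), hpow m,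
        apply_diagGL2_self_inv_pow_of_heckeT π hv hT he0 m]
    have hWa : whittakerModel π Λ v (diagGL2 a 1) = whittakerModel π Λ v (diagGL2 (ϖ ^ m) 1) := by
      rw [hau, whittakerModel_diagGL2_mul_of_valuation_eq_one π Λ hv _ hu]
    have habs : (((normAbs F (a : F) : ℝ≥0) : ℝ) : ℂ) ^ (s - 1 / 2) = (sq * t) ^ m := by
      rw [ha, NNReal.coe_zpow, ofReal_zpow_cpow hr0, inv_residueFieldCard_cpow_sub_one_half, zpow_natCast]
    simp only [hf_def, hw_def]
    rw [htilde, hcentral, map_smul, map_smul, smul_eq_mul, ← whittakerModel_apply, hWa, habs]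
    ring
  -- `‖w m‖` has the same bound as on the direct side (`|e| = 1`)
  have hwle : ∀ m, ‖w m‖ ≤ ‖Λ v‖ * (((m : ℝ) + 1) ^ 2 * y ^ m) := by
    intro m
    simp only [hw_def]
    rw [norm_mul, norm_pow, norm_inv, he1, inv_one, one_pow, one_mul, norm_mul, norm_pow, norm_mul,
      hsq_def, Complex.norm_real, Real.norm_of_nonneg hsq0.le, ht_def, hqs]
    have h := norm_whittakerModel_diagGL2_pow_le π hϖ hψ0 hΛ hv hx hT hA0 hA m
    calc ‖whittakerModel π Λ v (diagGL2 (ϖ ^ m) 1)‖ * (Real.sqrt (residueFieldCard F) * (residueFieldCard F : ℝ) ^ (-s.re)) ^ m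
        ≤ ‖Λ v‖ * (((m : ℝ) + 1) ^ 2 * (A / Real.sqrt (residueFieldCard F)) ^ m) *
            (Real.sqrt (residueFieldCard F) * (residueFieldCard F : ℝ) ^ (-s.re)) ^ m := by
          gcongr
      _ = ‖Λ v‖ * (((m : ℝ) + 1) ^ 2 * y ^ m) := by
          rw [hy_def, div_pow, mul_pow, mul_pow]
          field_simp
  have hy1 : ‖y‖ < 1 := by rw [Real.norm_eq_abs, abs_of_nonneg hy0]; exact hsA
  have hbsum : Summable fun m : ℕ => ((m : ℝ) + 1) ^ 2 * y ^ m := by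
    have h2 := summable_pow_mul_geometric_of_norm_lt_one 2 hy1
    have h1 := summable_pow_mul_geometric_of_norm_lt_one 1 hy1
    have h0 := summable_geometric_of_norm_lt_one hy1
    have : (fun m : ℕ => ((m : ℝ) + 1) ^ 2 * y ^ m) =
        fun m : ℕ => (m : ℝ) ^ 2 * y ^ m + 2 * ((m : ℝ) ^ 1 * y ^ m) + y ^ m := by
      funext m; ring
    rw [this]
    exact (h2.add (h1.mul_left 2)).add h0
  have hwsum : Summable fun m => ‖w m‖ :=
    Summable.of_nonneg_of_le (fun m => norm_nonneg _) hwle (hbsum.mul_left _)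
  -- measurability (a shell function is locally constant) and integrability
  have hcont : Continuous f := by
    refine IsLocallyConstant.continuous ((IsLocallyConstant.iff_exists_open f).2 fun a => ?_)
    refine ⟨{b : Fˣ | normAbs F (b : F) = normAbs F (a : F)}, (isLocallyConstant_normAbs_units (F := F)).isOpen_fiber _,
      rfl, fun b hb => ?_⟩
    obtain ⟨k, hk⟩ := exists_normAbs_eq_inv_zpow a.ne_zero
    by_cases hk0 : 0 ≤ k
    · obtain ⟨m, rfl⟩ : ∃ m : ℕ, k = m := ⟨k.toNat, (Int.toNat_of_nonneg hk0).symm⟩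
      rw [hfv m a hk, hfv m b (hb.trans hk)]
    · have h1 : 1 < normAbs F (a : F) := by
        rw [hk, ← zpow_zero ((residueFieldCard F : ℝ≥0)⁻¹)]
        exact (zpow_right_strictAnti₀ inv_residueFieldCard_pos inv_residueFieldCard_lt_one) (lt_of_not_ge hk0)
      rw [hf0 a h1, hf0 b (hb ▸ h1)]
  refine ⟨integrable_units_of_shell μ' hcont.aestronglyMeasurable hf0 hfv hwsum, ?_⟩
  rw [integral_norm_eq_tsum_shell μ' hf0 hfv hwsum]
  refine mul_le_mul_of_nonneg_left ?_ ENNReal.toReal_nonneg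
  rw [← tsum_mul_left]
  exact hwsum.tsum_le_tsum hwle (hbsum.mul_left _)

end Integral

end Literature.NumberTheory.Automorphic
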